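import Summits.CriticalPhenomena.PercolationContinuityZ3.Theorems.PercAnnulusCrossingIICLocalLimitSharp
import HarnessLib

/-!
# The IIC measure is mixing on far windows: `|ν(G ∩ E) − ν(G)·ν(E)| ≤ 2·ν(0 ↔ W) ≤ C·π(‖x‖)/π(m)` (lane RSW3, p1 gen 23)

builds on p205010 (kernel theorem, internal audit signed; external expert review pending) — USED through `θ(p_c) = 0` (inside
`…IICLocalLimitSharp`).

RSW3 lane (LANE 3 `prim-rsw3`), seat `prim-rsw3-p1` (gen 23).  Helper file (`--supports stmt-CriticalPhenomena-4575`); no definitions,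
no sorries.  Memo `run/shared/lean/prim/rsw3/P1-QM.md` §36.

`…IICLocalLimitSharp` gives `|ν(G ∩ E) − ν(G)·P_p(E)| ≤ ν(0 ↔ W)` and `|ν(E) − P_p(E)| ≤ ν(0 ↔ W)` for an event `E` read in a window with
sites `W` and any event `G` read off the window's edges.  Eliminating `P_p(E)`:

* **`iicMeasure_abs_real_inter_sub_mul_real_le_two_mul`** — every `(d, p)` with `θ(p) = 0` and `OneArmQuasiMultAt d p c`, every finite measure
  `ν` with Kesten's IIC limit property: **`|ν(G ∩ E) − ν(G)·ν(E)| ≤ 2·ν(∃ w ∈ W, 0 ↔ w)`** — A WINDOW DECORRELATES FROM EVERYTHING READ OFF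
  ITS EDGES (near or far, including events at the root) AT THE RATE OF ITS VISIT PROBABILITY: the IIC measure is mixing, quantitatively;
* **`exists_iicMeasure_abs_real_inter_sub_mul_real_le_div_criticalProbI`** — at `p_c(ℤ^d)`, `d ≥ 2`, under (A2)□(s,L) + `CU⁺_l`: there is `C`
  with **`|ν(G ∩ E) − ν(G)·ν(E)| ≤ C·π_{p_c}(‖x‖)/π_{p_c}(m)`** for every IIC probability measure `ν`, every window `W ⊆ Λ_x(m)` (`m ≥ 1`,
  `l(m+2) ≤ ‖x‖`), every `E` read in `W` and every `G` read off the edges of `E`; in particular two windows `Λ_{x₁}(m₁)`, `Λ_{x₂}(m₂)` with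
  disjoint edge sets decorrelate at rate `min_i π(‖x_i‖)/π(m_i)` (apply with the better of the two as `E`).
Compare gen 10 (`…IICGen10Master`: short-range correlations on ALL events, qualitative / with gen 7's union-bound rate).
References: H. Kesten, PTRF 73 (1986) Thm. (3); D. Basu, A. Sapozhnikov, ECP 22 (2017) §1.
-/

noncomputable section

namespace Summit.CriticalPhenomena.PercolationContinuityZ3.Theorems.Crossing

open MeasureTheory Filter Topology Literature.Probability.Percolation Literature.Probability.LatticeModels
open Literature.Probability.Percolation.DCT16
open Summit.CriticalPhenomena.PercolationContinuityZ3.Theorems.SurfaceTension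
open scoped Literature.Probability.Percolation

variable {d : ℕ}

/-- **THE IIC MEASURE IS MIXING ON FAR WINDOWS: `|ν(G ∩ E) − ν(G)·ν(E)| ≤ 2·ν(∃ w ∈ W, 0 ↔ w)`** for every finite measure `ν` with Kesten's IIC
limit property at `(d, p)` (`d ≥ 1`, `p > 0`, `θ(p) = 0`, `OneArmQuasiMultAt d p c`, `c > 0`), every event `E` determined by a finite edge set
`F` with endpoints in `W` and every event `G` determined by a finite edge set disjoint from `F` (`…IICLocalLimitSharp` twice and
`ν(G) ≤ 1`). [cite: Kesten1986, Thm. (3)] -/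
theorem iicMeasure_abs_real_inter_sub_mul_real_le_two_mul (hd : 1 ≤ d) (p : unitInterval) (hp : 0 < (p : ℝ))
    (hθ : theta (zdGraph d) 0 p = 0) {c : ℝ} (hc : 0 < c) (hQM : OneArmQuasiMultAt d p c) {ν : Measure (BondConfig (Site d))} [IsFiniteMeasure ν]
    (hν : ∀ (F : Finset (Sym2 (Site d))) (E : Set (BondConfig (Site d))), MeasurableSet E → DeterminedBy E ↑F →
      Tendsto (fun n : ℕ => (bondPercolation (zdGraph d) p).real (E ∩ siteToBoundary d n) / oneArmProb d p n)
        atTop (𝓝 (ν.real E)))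
    {F : Finset (Sym2 (Site d))} {W : Finset (Site d)} (hFW : ∀ e ∈ F, ∀ w ∈ e, w ∈ W)
    {E : Set (BondConfig (Site d))} (hE : DeterminedBy E (↑F : Set (Sym2 (Site d))))
    {T : Finset (Sym2 (Site d))} {G : Set (BondConfig (Site d))} (hG : DeterminedBy G (↑T : Set (Sym2 (Site d))))
    (hTF : Disjoint T F) :
    |ν.real (G ∩ E) - ν.real G * ν.real E| ≤ 2 * ν.real {ω | ∃ w ∈ W, ω ∈ (openConn (0 : Site d) w : Set (BondConfig (Site d)))} := by
  set V := ν.real {ω | ∃ w ∈ W, ω ∈ (openConn (0 : Site d) w : Set (BondConfig (Site d)))} with hV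
  set P := (bondPercolation (zdGraph d) p).real E with hP
  have h1 := iicMeasure_abs_real_inter_sub_mul_le_real_exists hd p hp hθ hc hQM hν hFW hE hG hTF
  have h2 := iicMeasure_abs_real_sub_le_real_exists hd p hp hθ hc hQM hν hFW hE
  have hG1 : ν.real G ≤ 1 := by
    calc ν.real G ≤ ν.real Set.univ := measureReal_mono (Set.subset_univ _) (measure_ne_top _ _)
      _ = 1 := iicMeasure_real_univ hd p hp hν
  have hG0 : 0 ≤ ν.real G := measureReal_nonneg
  -- `|ν(G∩E) − ν(G)ν(E)| ≤ |ν(G∩E) − ν(G)P(E)| + ν(G)|P(E) − ν(E)|`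
  have h3 : |ν.real G * P - ν.real G * ν.real E| ≤ V := by
    rw [← mul_sub, abs_mul, abs_of_nonneg hG0]
    calc ν.real G * |P - ν.real E| ≤ 1 * |P - ν.real E| := mul_le_mul_of_nonneg_right hG1 (abs_nonneg _)
      _ = |ν.real E - P| := by rw [one_mul, abs_sub_comm]
      _ ≤ V := h2
  calc |ν.real (G ∩ E) - ν.real G * ν.real E|
      = |(ν.real (G ∩ E) - ν.real G * P) + (ν.real G * P - ν.real G * ν.real E)| := by ring_nf
    _ ≤ |ν.real (G ∩ E) - ν.real G * P| + |ν.real G * P - ν.real G * ν.real E| := abs_add_le _ _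
    _ ≤ V + V := add_le_add h1 h3
    _ = 2 * V := by ring

open Classical in
/-- **WINDOW MIXING AT `p_c(ℤ^d)` AT RATE `π(‖x‖)/π(m)`** (`d ≥ 2`; (A2)□ at aspect `(s,L)`, `2 ≤ s ≤ L`, `ϰ > 0`; `CU⁺_l(c_U)`, `l ≥ 2`, `c_U > 0`):
there is `C > 0` with **`|ν(G ∩ E) − ν(G)·ν(E)| ≤ C·π_{p_c}(‖x‖_∞)/π_{p_c}(m)`** for every IIC probability measure `ν`, every `m ≥ 1` and `x`
with `l(m+2) ≤ ‖x‖_∞`, every finite `W ⊆ x + Λ(m)`, every `E` determined by a finite edge set `F` with endpoints in `W` and every `G` determined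
by a finite edge set disjoint from `F`. [cite: Kesten1986, Thm. (3), (8)] [cite: BasuSapozhnikov2017ECP, Thm. 1.1] -/
theorem exists_iicMeasure_abs_real_inter_sub_mul_real_le_div_criticalProbI (hd : 2 ≤ d) {s L : ℕ} (hs : 2 ≤ s) (hsL : s ≤ L)
    {ϰ : ℝ} (hϰ : 0 < ϰ) (hA2 : SetToSetQuasiMultAspectAt d (criticalProbI d) s L ϰ) {l : ℕ} (hl : 2 ≤ l) {cU : ℝ} (hcU : 0 < cU)
    (hCU : ∀ a : ℕ, 1 ≤ a → ∀ E : Set (BondConfig (Site d)), IsUpperSet E → MeasurableSet E →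
      cU * (bondPercolation (zdGraph d) (criticalProbI d)).real E ≤ (bondPercolation (zdGraph d) (criticalProbI d)).real (E ∩
        {ω : BondConfig (Site d) | ∀ t ∈ innerBoundary (zdGraph d) (box d a), ∀ s ∈ innerBoundary (zdGraph d) (box d (l * a)),
          ∀ t' ∈ innerBoundary (zdGraph d) (box d a), ∀ s' ∈ innerBoundary (zdGraph d) (box d (l * a)),
          ω ∈ openConnIn (↑((box d (l * a) \ box d a) ∪ innerBoundary (zdGraph d) (box d a)) : Set (Site d)) t s →
          ω ∈ openConnIn (↑((box d (l * a) \ box d a) ∪ innerBoundary (zdGraph d) (box d a)) : Set (Site d)) t' s' →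
          ω ∈ openConnIn (↑((box d (l * a) \ box d a) ∪ innerBoundary (zdGraph d) (box d a)) : Set (Site d)) s s'})) :
    ∃ C : ℝ, 0 < C ∧ ∀ (ν : Measure (BondConfig (Site d))) [IsProbabilityMeasure ν],
      (∀ (F : Finset (Sym2 (Site d))) (E : Set (BondConfig (Site d))), MeasurableSet E → DeterminedBy E ↑F →
        Tendsto (fun n : ℕ => (bondPercolation (zdGraph d) (criticalProbI d)).real (E ∩ siteToBoundary d n) /
          oneArmProb d (criticalProbI d) n) atTop (𝓝 (ν.real E))) →
      ∀ (m : ℕ) (x : Site d) (W : Finset (Site d)) (F T : Finset (Sym2 (Site d))) (E G : Set (BondConfig (Site d))),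
        1 ≤ m → l * (m + 2) ≤ Site.supNorm x → (∀ w ∈ W, w ∈ (box d m).image (· + x)) → (∀ e ∈ F, ∀ w ∈ e, w ∈ W) →
        DeterminedBy E (↑F : Set (Sym2 (Site d))) → DeterminedBy G (↑T : Set (Sym2 (Site d))) → Disjoint T F →
        |ν.real (G ∩ E) - ν.real G * ν.real E| ≤ C * oneArmProb d (criticalProbI d) (Site.supNorm x) / oneArmProb d (criticalProbI d) m := by
  have hd1 : 1 ≤ d := le_trans (by norm_num) hd
  have hp : 0 < ((criticalProbI d : unitInterval) : ℝ) := by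
    rw [coe_criticalProbI]; exact criticalProb_zd_pos d hd1
  have hπ : ∀ m : ℕ, 0 < oneArmProb d (criticalProbI d) m := fun m => oneArmProb_pos hd1 _ hp m
  have hθ : theta (zdGraph d) 0 (criticalProbI d) = 0 := CSH.percolationContinuity_allDimensions d hd
  obtain ⟨cq, hcq, hQM⟩ := oneArmQuasiMultAt_of_setToSetQuasiMultAspectAt hd hs hsL hϰ hA2
  obtain ⟨cN, CN, hcN, hCN, hN⟩ := exists_iicMeasure_real_exists_openConn_ball_two_sided_criticalProbI hd hs hsL hϰ hA2 hl hcU hCU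
  refine ⟨2 * CN, by positivity, fun ν _ hν m x W F T E G hm hlx hW hFW hE hG hTF => ?_⟩
  have hπm := hπ m
  obtain ⟨-, hN2⟩ := hN ν hν m x hm hlx
  have hsub : {ω | ∃ w ∈ W, ω ∈ (openConn (0 : Site d) w : Set (BondConfig (Site d)))} ⊆
      {ω | ∃ q ∈ (box d m).image (· + x), ω ∈ (openConn (0 : Site d) q : Set (BondConfig (Site d)))} :=
    fun ω ⟨w, hw, h⟩ => ⟨w, hW w hw, h⟩
  have hVle : ν.real {ω | ∃ w ∈ W, ω ∈ (openConn (0 : Site d) w : Set (BondConfig (Site d)))} ≤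
      CN * oneArmProb d (criticalProbI d) (Site.supNorm x) / oneArmProb d (criticalProbI d) m := by
    rw [le_div_iff₀ hπm, mul_comm]
    exact (mul_le_mul_of_nonneg_left (measureReal_mono hsub (measure_ne_top _ _)) hπm.le).trans hN2
  calc |ν.real (G ∩ E) - ν.real G * ν.real E| ≤ 2 * ν.real {ω | ∃ w ∈ W, ω ∈ (openConn (0 : Site d) w : Set (BondConfig (Site d)))} :=
        iicMeasure_abs_real_inter_sub_mul_real_le_two_mul hd1 _ hp hθ hcq hQM hν hFW hE hG hTF
    _ ≤ 2 * (CN * oneArmProb d (criticalProbI d) (Site.supNorm x) / oneArmProb d (criticalProbI d) m) :=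
        mul_le_mul_of_nonneg_left hVle zero_le_two
    _ = 2 * CN * oneArmProb d (criticalProbI d) (Site.supNorm x) / oneArmProb d (criticalProbI d) m := by ring

end Summit.CriticalPhenomena.PercolationContinuityZ3.Theorems.Crossing

end
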